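import Mathlib.Analysis.Complex.Basic
import Literature.MathematicalPhysics.QuantumFieldTheory.TphiSeminorm
import HarnessLib

/-!
# Crux `BirComplexStableXYR` (stmt-HubbardSuperconductivity-14845), line `fat-gaussian-defect-calculus`:
# stub G1 `stub_tphiSeminorm_clm_le` — the `T_φ(𝔥)` seminorm of a continuous linear functional

Helper (`--supports`) for the crux
`Summit.HubbardSuperconductivity.HubbardSuperconductivity.Theses.BalabanIR.BirComplexStableXYR`, line
`fat-gaussian-defect-calculus` (lead skeleton `Cruxes/BirComplexStableXYR/Lines/fat_gaussian_defect_calculus.lean`),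
registered stub G1 `stub_tphiSeminorm_clm_le` (generic, chapter 2).

**Statement.** For a real normed space `E`, a continuous `ℝ`-linear functional `ℓ : E →L[ℝ] ℂ`, a Taylor
order `N`, a field unit `𝔥 ≥ 0` and a field `φ : E`, the Bauerschmidt–Brydges–Slade seminorm
(`tphiSeminorm`, `Literature.MathematicalPhysics.QuantumFieldTheory.TphiSeminorm`, BBS 2019 Def. 7.1.1)
of `ℓ` satisfies `‖ℓ‖_{T_φ(𝔥)} ≤ ‖ℓ φ‖ + 𝔥‖ℓ‖` (equality for `N ≥ 1`, `‖ℓ φ‖` for `N = 0`).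

**Proof.** The seminorm is the finite sum `∑_{p ≤ N} (𝔥^p/p!) ‖Dᵖℓ(φ)‖`.  The `p = 0` term is `‖ℓ φ‖`
(`norm_iteratedFDeriv_zero`); the `p = 1` term is `𝔥‖D¹ℓ(φ)‖ = 𝔥‖fderiv ℓ φ‖ = 𝔥‖ℓ‖`
(`norm_iteratedFDeriv_one`, `ContinuousLinearMap.fderiv`); for `p ≥ 2`,
`‖Dᵖℓ(φ)‖ = ‖D^{p-1}(fderiv ℓ)(φ)‖ = ‖D^{p-1}(const ℓ)(φ)‖ = 0` (`norm_iteratedFDeriv_fderiv`,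
`iteratedFDeriv_succ_const`).  Split the sum twice with `Finset.sum_range_succ'` and kill the tail with
`Finset.sum_eq_zero`.  No definitions; sorry-free; everything is Mathlib. [folklore]
-/

set_option linter.dupNamespace false -- `Summit.<S>.<S>.Theorems…` repeats the summit name (D-0017 layout)

noncomputable section

namespace Summit.HubbardSuperconductivity.HubbardSuperconductivity.Theorems.FSUnfolding

open scoped BigOperators Nat
open Literature.MathematicalPhysics.QuantumFieldTheory

/-- The Fréchet derivatives of order `p ≥ 2` of a continuous linear functional vanish. [folklore] -/
theorem hscG1_norm_iteratedFDeriv_clm_two_le {E : Type*} [NormedAddCommGroup E] [NormedSpace ℝ E]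
    (ℓ : E →L[ℝ] ℂ) (φ : E) (p : ℕ) (hp : 2 ≤ p) : ‖iteratedFDeriv ℝ p (fun x => ℓ x) φ‖ = 0 := by
  obtain ⟨q, rfl⟩ : ∃ q, p = q + 1 + 1 := ⟨p - 2, by omega⟩
  have hfd : fderiv ℝ (fun x => ℓ x) = fun _ => ℓ := by
    funext u
    exact ContinuousLinearMap.fderiv ℓ
  rw [← norm_iteratedFDeriv_fderiv, hfd, iteratedFDeriv_succ_const, Pi.zero_apply, norm_zero]

/-- **stub G1 (S/M, generic): `T_φ` seminorm of a continuous linear functional.**  For `ℓ : E →L[ℝ] ℂ`,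
`tphiSeminorm N 𝔥 ℓ φ ≤ ‖ℓ φ‖ + 𝔥‖ℓ‖` (`D¹ℓ = ℓ` has norm `‖ℓ‖` through the curry isometry, `Dᵖℓ = 0` for
`p ≥ 2`; for `N = 0` the bound is `‖ℓ φ‖`). [folklore] -/
theorem stub_tphiSeminorm_clm_le :
    ∀ (E : Type) [NormedAddCommGroup E] [NormedSpace ℝ E] (ℓ : E →L[ℝ] ℂ) (N : ℕ) (𝔥 : ℝ), 0 ≤ 𝔥 →
      ∀ φ : E, tphiSeminorm N 𝔥 (fun x => ℓ x) φ ≤ ‖ℓ φ‖ + 𝔥 * ‖ℓ‖ := by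
  intro E _ _ ℓ N 𝔥 h𝔥 φ
  have h0 : 0 ≤ 𝔥 * ‖ℓ‖ := mul_nonneg h𝔥 (norm_nonneg _)
  rcases N with _ | N
  · rw [tphiSeminorm_zero_order]
    linarith
  · rw [tphiSeminorm_def, Finset.sum_range_succ', Finset.sum_range_succ', Finset.sum_eq_zero]
    · simp
      linarith
    · intro p _
      rw [hscG1_norm_iteratedFDeriv_clm_two_le ℓ φ (p + 1 + 1) (by omega), mul_zero]

end Summit.HubbardSuperconductivity.HubbardSuperconductivity.Theorems.FSUnfolding

end
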